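import Summits.AtomisticToContinuum.FouriersLaw.Theses.MatthiessenLadder
import Summits.AtomisticToContinuum.FouriersLaw.Theorems.MatthiessenLadderPrefixSteadyStatesStubHarmonicNessUnique
import Literature.MathematicalPhysics.KineticTheory.SiteChainLaSalleUniqueness
import Literature.MathematicalPhysics.KineticTheory.CellChainLangevin
import Literature.MathematicalPhysics.KineticTheory.ConfinedLocalMinorization
import HarnessLib

/-!
# At most one invariant probability measure for the Langevin kernels of a cell chain

Helper for crux `PrefixSteadyStates` (route `MatthiessenLadder`, item stmt-AtomisticToContinuum-12778,
registered stub `stub_cellChainInvariantUnique` of the line `registered`). For EVERY cell chain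
`cellChain ω₂ lam β γ c` (`U_i = ω₂q²/2 + [c i] lam q⁴/4`, `V_i = r²/2 + [c i] β r⁴/4`, baths `γ` at the
two ends; `ω₂, γ > 0`, `lam, β ≥ 0`, `N ≥ 1`, `T_L > 0`, `T_R ≥ 0`) the Langevin kernels
`(cellChain ω₂ lam β γ c).langevinKernel N T_L T_R t` of the model-free SDE pipeline leave at most one
probability measure invariant. Assembled from in-tree pieces, Hörmander-free:

* **Kalman at the equilibrium from the left bath**: the cubic forces `[c i] lam q_i³`,
  `[c k] β (q_{k+1} - q_k)³` have vanishing derivative at `q = 0`, so the cell chain and its harmonic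
  host `pinnedChain ω₂ 0 0 γ` have the SAME linearised drift at `0`
  (`cellChain_fderiv_langevinDrift_zero_U3`); Kalman's condition is then the landed
  `harmonicChain_kalman_bathVecL`;
* a local small set in a time window: MODEL-FREE `ConfinedDrift.exists_localSmall_window` applied to
  `(cellChain_uniformlyConfining …).confinedDrift N`;
* LaSalle + pointed irreducibility + small-set cover:
  `SiteChain.UniformlyConfining.invariant_unique_of_localSmall` (`SiteChainLaSalleUniqueness.lean`)
  with the sitewise inputs `V_i' = r + β_i r³` injective (`cellChain_deriv_V_injective_U3`) and
  `∑_i q_i ∂_iΦ(q) ≥ ω₂ |q|²` (`cellChain_eq_zero_of_dPotential_eq_zero_U3`).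
-/

noncomputable section

open MeasureTheory ProbabilityTheory Filter Topology Set
open scoped NNReal ENNReal ContDiff

namespace Summit.AtomisticToContinuum.FouriersLaw.Theorems.PrefixSteadyStates.LineRegistered

open Literature.MathematicalPhysics.KineticTheory.HeatConduction
open Literature.MathematicalPhysics.KineticTheory Literature.Probability.Process

variable {N : ℕ}

/-! ### Sitewise inputs of LaSalle for the cell chains -/

/-- Every bond force `V_i' = r + [c i] β r³` of a cell chain is injective (`β ≥ 0`). [folklore] -/
theorem cellChain_deriv_V_injective_U3 (ω₂ lam : ℝ) {β : ℝ} (hβ : 0 ≤ β) (γ : ℝ) (c : ℕ → Bool)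
    (i : ℕ) : Function.Injective (deriv ((cellChain ω₂ lam β γ c).V i)) := by
  rw [cellChain_V]
  exact pinnedChain_deriv_V_injective ω₂ _ (ite_amplitude_mem_Icc hβ (c i)).1 γ

/-- **The only critical point of the potential of a cell chain is the origin** (`ω₂ > 0`,
`lam, β ≥ 0`): `∂_iΦ(q) = 0` for all `i` forces `q = 0`, since
`∑_i q_i ∂_iΦ(q) = ω₂|q|² + ∑_i λ_i q_i⁴ + ∑_{bonds} (Δ² + β_k Δ⁴) ≥ ω₂|q|²`. [folklore] -/
theorem cellChain_eq_zero_of_dPotential_eq_zero_U3 {ω₂ lam β : ℝ} (hω : 0 < ω₂) (hl : 0 ≤ lam)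
    (hβ : 0 ≤ β) (γ : ℝ) (c : ℕ → Bool) (N : ℕ) (q : Fin N → ℝ)
    (h : ∀ i, (cellChain ω₂ lam β γ c).dPotential N i q = 0) : q = 0 := by
  have hsum : ∑ i, q i * (cellChain ω₂ lam β γ c).dPotential N i q = 0 := by simp [h]
  rw [SiteChain.sum_mul_dPotential] at hsum
  simp only [cellChain_deriv_U_eq, cellChain_deriv_V_eq] at hsum
  have h1 : ω₂ * ∑ i, q i ^ 2 ≤ ∑ i, q i * (ω₂ * q i + (if c i.val then lam else 0) * q i ^ 3) := by
    rw [Finset.mul_sum]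
    refine Finset.sum_le_sum fun i _ => ?_
    have hl0 := (ite_amplitude_mem_Icc hl (c i.val)).1
    have : 0 ≤ (if c i.val then lam else 0) * q i ^ 4 := mul_nonneg hl0 (by positivity)
    nlinarith
  have h2 : 0 ≤ ∑ k : Fin N, ∑ l : Fin N, (if l.val = k.val + 1 then
      ((q l - q k) + (if c k.val then β else 0) * (q l - q k) ^ 3) * (q l - q k) else 0) := by
    refine Finset.sum_nonneg fun k _ => Finset.sum_nonneg fun l _ => ?_
    by_cases hlk : l.val = k.val + 1
    · rw [if_pos hlk]
      have hb0 := (ite_amplitude_mem_Icc hβ (c k.val)).1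
      have h4 : 0 ≤ (if c k.val then β else 0) * (q l - q k) ^ 4 := mul_nonneg hb0 (by positivity)
      have e : ((q l - q k) + (if c k.val then β else 0) * (q l - q k) ^ 3) * (q l - q k) =
          (q l - q k) ^ 2 + (if c k.val then β else 0) * (q l - q k) ^ 4 := by ring
      rw [e]
      exact add_nonneg (sq_nonneg _) h4
    · rw [if_neg hlk]
  have h3 : ∑ i, q i ^ 2 ≤ 0 := by
    by_contra hcon
    have hpos : 0 < ω₂ * ∑ i, q i ^ 2 := mul_pos hω (not_le.1 hcon)
    linarith
  have h4 := (Finset.sum_eq_zero_iff_of_nonneg fun i _ => sq_nonneg (q i)).1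
    (le_antisymm h3 (Finset.sum_nonneg fun i _ => sq_nonneg (q i)))
  funext i
  exact pow_eq_zero_iff two_ne_zero |>.1 (h4 i (Finset.mem_univ i))

/-! ### The linearisation at the equilibrium is that of the harmonic host -/

/-- The origin is an equilibrium of the Langevin drift of every cell chain. [folklore] -/
theorem cellChain_langevinDrift_zero_U3 (ω₂ lam β γ : ℝ) (c : ℕ → Bool) (N : ℕ) :
    (cellChain ω₂ lam β γ c).langevinDrift N 0 = 0 := by
  have hUd : ∀ i, Differentiable ℝ ((cellChain ω₂ lam β γ c).U i) := fun i => by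
    rw [cellChain_U]; exact (pinnedChain_contDiff_U _ _ _ _ (n := 1)).differentiable one_ne_zero
  have hVd : ∀ i, Differentiable ℝ ((cellChain ω₂ lam β γ c).V i) := fun i => by
    rw [cellChain_V]; exact (pinnedChain_contDiff_V _ _ _ _ (n := 1)).differentiable one_ne_zero
  rw [(cellChain ω₂ lam β γ c).langevinDrift_eq hUd hVd N]
  refine Prod.ext rfl (funext fun i => ?_)
  simp [SiteChain.dPotential, cellChain_deriv_U_eq, cellChain_deriv_V_eq]

/-- **The cell chain and its harmonic host have the same linearised drift at the equilibrium**: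
`D(Y_cell)(0) = D(Y_harm)(0)`, the difference `Y_cell - Y_harm = (0, -λ_i q_i³ - ∑ β_k Δ³ (…))`
being cubic in the positions. [folklore] -/
theorem cellChain_fderiv_langevinDrift_zero_U3 (ω₂ lam β γ : ℝ) (c : ℕ → Bool) (N : ℕ) :
    fderiv ℝ ((cellChain ω₂ lam β γ c).langevinDrift N) 0 =
      fderiv ℝ ((pinnedChain ω₂ 0 0 γ).drift N) 0 := by
  set Pc := cellChain ω₂ lam β γ c with hPc
  set Ph := pinnedChain ω₂ 0 0 γ with hPh
  -- the cubic remainder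
  set R : PhaseSpace N → PhaseSpace N := fun x => ((0 : Fin N → ℝ), fun i : Fin N =>
    -((if c i.val then lam else 0) * x.1 i ^ 3 +
      ∑ k : Fin N, ∑ l : Fin N, if l.val = k.val + 1 then
        (if c k.val then β else 0) * (x.1 l - x.1 k) ^ 3 *
          ((if l = i then 1 else 0) - (if k = i then 1 else 0)) else 0)) with hR
  have hUd : ∀ i, Differentiable ℝ (Pc.U i) := fun i => by
    rw [hPc, cellChain_U]; exact (pinnedChain_contDiff_U _ _ _ _ (n := 1)).differentiable one_ne_zero
  have hVd : ∀ i, Differentiable ℝ (Pc.V i) := fun i => by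
    rw [hPc, cellChain_V]; exact (pinnedChain_contDiff_V _ _ _ _ (n := 1)).differentiable one_ne_zero
  have hUd' : Differentiable ℝ Ph.U := (pinnedChain_contDiff_U ω₂ 0 0 γ (n := 1)).differentiable one_ne_zero
  have hVd' : Differentiable ℝ Ph.V := (pinnedChain_contDiff_V ω₂ 0 0 γ (n := 1)).differentiable one_ne_zero
  -- the splitting `Y_cell = Y_harm + R`, from the sitewise closed forms of the forces
  have key : ∀ (q : Fin N → ℝ) (i : Fin N), Pc.dPotential N i q = Ph.dPotential N i q +
      ((if c i.val then lam else 0) * q i ^ 3 +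
        ∑ k : Fin N, ∑ l : Fin N, if l.val = k.val + 1 then
          (if c k.val then β else 0) * (q l - q k) ^ 3 *
            ((if l = i then 1 else 0) - (if k = i then 1 else 0)) else 0) := by
    intro q i
    simp only [SiteChain.dPotential, OscillatorChain.dPotential, hPc, hPh, cellChain_deriv_U_eq,
      cellChain_deriv_V_eq, pinnedChain_deriv_U, pinnedChain_deriv_V]
    have hs : ∑ k : Fin N, ∑ l : Fin N, (if l.val = k.val + 1 then
        (q l - q k + (if c k.val then β else 0) * (q l - q k) ^ 3) *
          ((if l = i then 1 else 0) - (if k = i then 1 else 0)) else (0 : ℝ)) =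
        (∑ k : Fin N, ∑ l : Fin N, (if l.val = k.val + 1 then
          (q l - q k + 0 * (q l - q k) ^ 3) * ((if l = i then 1 else 0) - (if k = i then 1 else 0))
          else (0 : ℝ))) +
        ∑ k : Fin N, ∑ l : Fin N, (if l.val = k.val + 1 then
          (if c k.val then β else 0) * (q l - q k) ^ 3 *
            ((if l = i then 1 else 0) - (if k = i then 1 else 0)) else (0 : ℝ)) := by
      rw [← Finset.sum_add_distrib]
      refine Finset.sum_congr rfl fun k _ => ?_
      rw [← Finset.sum_add_distrib]
      refine Finset.sum_congr rfl fun l _ => ?_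
      split_ifs <;> ring
    rw [hs]
    ring
  have hγc : Pc.γ = γ := rfl
  have hγh : Ph.γ = γ := rfl
  have hsplit : Pc.langevinDrift N = fun x => Ph.drift N x + R x := by
    rw [Pc.langevinDrift_eq hUd hVd N, Ph.drift_eq hUd' hVd' N]
    funext x
    refine Prod.ext (by simp [hR]) (funext fun i => ?_)
    simp only [hR, Prod.snd_add, Pi.add_apply, hγc, hγh]
    rw [key x.1 i]
    ring
  -- `R` has zero derivative at the origin
  have hq : ∀ j : Fin N, HasFDerivAt (fun x : PhaseSpace N => x.1 j)
      ((ContinuousLinearMap.proj j).comp (ContinuousLinearMap.fst ℝ (Fin N → ℝ) (Fin N → ℝ))) 0 :=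
    fun j => ((ContinuousLinearMap.proj j).comp
      (ContinuousLinearMap.fst ℝ (Fin N → ℝ) (Fin N → ℝ))).hasFDerivAt
  have hcube : ∀ j : Fin N, HasFDerivAt (fun x : PhaseSpace N => x.1 j ^ 3)
      (0 : PhaseSpace N →L[ℝ] ℝ) 0 := fun j => by
    have h := (hq j).pow 3
    simpa using h
  have hbond : ∀ k l : Fin N, HasFDerivAt (fun x : PhaseSpace N => (x.1 l - x.1 k) ^ 3)
      (0 : PhaseSpace N →L[ℝ] ℝ) 0 := fun k l => by
    have h := ((hq l).sub (hq k)).pow 3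
    simpa using h
  have hRi : ∀ i : Fin N, HasFDerivAt (fun x : PhaseSpace N => (R x).2 i) (0 : PhaseSpace N →L[ℝ] ℝ) 0 := by
    intro i
    simp only [hR]
    have hterm : ∀ k l : Fin N, HasFDerivAt (fun x : PhaseSpace N => if l.val = k.val + 1 then
        (if c k.val then β else 0) * (x.1 l - x.1 k) ^ 3 *
          ((if l = i then 1 else 0) - (if k = i then 1 else 0)) else (0 : ℝ))
        (0 : PhaseSpace N →L[ℝ] ℝ) 0 := by
      intro k l
      by_cases hlk : l.val = k.val + 1
      · simp only [if_pos hlk]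
        have h := ((hbond k l).const_mul (if c k.val then β else 0)).mul_const
          ((if l = i then (1 : ℝ) else 0) - (if k = i then 1 else 0))
        simpa using h
      · simp only [if_neg hlk]
        exact hasFDerivAt_const _ _
    have hsum : HasFDerivAt (fun x : PhaseSpace N => ∑ k : Fin N, ∑ l : Fin N,
        if l.val = k.val + 1 then (if c k.val then β else 0) * (x.1 l - x.1 k) ^ 3 *
          ((if l = i then 1 else 0) - (if k = i then 1 else 0)) else (0 : ℝ))
        (0 : PhaseSpace N →L[ℝ] ℝ) 0 := by
      have h := HasFDerivAt.fun_sum (u := Finset.univ) fun k _ =>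
        HasFDerivAt.fun_sum (u := Finset.univ) fun l _ => hterm k l
      simpa using h
    have h := (((hcube i).const_mul (if c i.val then lam else 0)).add hsum).neg
    exact h.congr_fderiv (by simp)
  have hR0 : HasFDerivAt R (0 : PhaseSpace N →L[ℝ] PhaseSpace N) 0 := by
    have h2 : HasFDerivAt (fun x : PhaseSpace N => (R x).2) (0 : PhaseSpace N →L[ℝ] (Fin N → ℝ)) 0 :=
      hasFDerivAt_pi'' fun i => by simpa using hRi i
    have h1 : HasFDerivAt (fun x : PhaseSpace N => (R x).1) (0 : PhaseSpace N →L[ℝ] (Fin N → ℝ)) 0 := by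
      simp only [hR]
      exact hasFDerivAt_const _ _
    have h := h1.prodMk h2
    have e : (0 : PhaseSpace N →L[ℝ] (Fin N → ℝ)).prod (0 : PhaseSpace N →L[ℝ] (Fin N → ℝ)) =
        (0 : PhaseSpace N →L[ℝ] PhaseSpace N) := by
      ext v <;> simp
    simp only [Prod.mk.eta] at h
    rw [e] at h
    exact h
  -- conclude
  have hYh : DifferentiableAt ℝ (Ph.drift N) 0 :=
    ((pinnedChain_contDiff_drift ω₂ 0 0 γ N (n := 1)).differentiable one_ne_zero) 0
  have h : HasFDerivAt (Pc.langevinDrift N) (fderiv ℝ (Ph.drift N) 0 + 0) 0 := by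
    rw [hsplit]
    exact hYh.hasFDerivAt.add hR0
  rw [add_zero] at h
  exact h.fderiv

/-- **Kalman's condition at the equilibrium for the left bath direction of a cell chain**
(`γ, T_L > 0`, `N ≥ 1`): inherited from the harmonic host through the common linearisation.
[folklore] -/
theorem cellChain_kalman_noiseVecL_U3 {ω₂ lam β γ : ℝ} (hγ : 0 < γ) (c : ℕ → Bool) (hN : 0 < N)
    {T_L : ℝ} (hTL : 0 < T_L) (ℓ : PhaseSpace N →ₗ[ℝ] ℝ)
    (h : ∀ j : ℕ, ℓ (((fderiv ℝ ((cellChain ω₂ lam β γ c).langevinDrift N) 0) ^ j)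
      ((cellChain ω₂ lam β γ c).noiseVecL N T_L)) = 0) :
    ℓ = 0 := by
  rw [cellChain_fderiv_langevinDrift_zero_U3] at h
  exact harmonicChain_kalman_bathVecL hγ hN hTL ℓ h

/-- **A local small set of a cell chain at the equilibrium, in a time window** (Hörmander-free:
`ConfinedDrift.exists_localSmall_window`). [folklore] -/
theorem cellChain_localSmall_U3 {ω₂ lam β γ : ℝ} (hω : 0 < ω₂) (hl : 0 ≤ lam) (hβ : 0 ≤ β)
    (hγ : 0 < γ) (c : ℕ → Bool) (hN : 0 < N) {T_L : ℝ} (hTL : 0 < T_L) (T_R : ℝ) :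
    ∃ (G₀ U₀ : Set (PhaseSpace N)) (η : ℝ≥0∞) (t₀ δ : ℝ), IsOpen G₀ ∧ (0 : PhaseSpace N) ∈ G₀ ∧
      IsOpen U₀ ∧ U₀.Nonempty ∧ 0 < η ∧ 0 < δ ∧ δ ≤ t₀ ∧
      ∀ t : ℝ≥0, t₀ - δ ≤ (t : ℝ) → (t : ℝ) ≤ t₀ + δ → ∀ w ∈ G₀,
        η • (volume : Measure (PhaseSpace N)).restrict U₀ ≤
          (cellChain ω₂ lam β γ c).langevinKernel N T_L T_R t w := by
  set P := cellChain ω₂ lam β γ c with hP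
  have hPc : P.UniformlyConfining := cellChain_uniformlyConfining hω hl hβ hγ.le c
  let D : ConfinedDrift (P.langevinDrift N) := (hPc.confinedDrift N).toConfinedDrift
  have hY : ContDiff ℝ 1 (P.langevinDrift N) := P.contDiff_one_langevinDrift hPc.contDiff_U hPc.contDiff_V N
  have hx₀ : P.langevinDrift N 0 = 0 := cellChain_langevinDrift_zero_U3 ω₂ lam β γ c N
  have hv₁ : P.noiseVecL N T_L ∈ D.noise := hPc.noiseVecL_mem_noise N T_L
  have hv₂ : P.noiseVecR N T_R ∈ D.noise := hPc.noiseVecR_mem_noise N T_R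
  have hKal : ∀ ℓ : PhaseSpace N →ₗ[ℝ] ℝ,
      (∀ j : ℕ, ℓ (((fderiv ℝ (P.langevinDrift N) 0) ^ j) (P.noiseVecL N T_L)) = 0) → ℓ = 0 :=
    fun ℓ h => cellChain_kalman_noiseVecL_U3 hγ c hN hTL ℓ h
  haveI hpi : (volume : Measure (Fin N → ℝ)).IsAddHaarMeasure := isAddHaarMeasure_volume_pi _
  haveI : (volume : Measure (PhaseSpace N)).IsAddHaarMeasure :=
    Measure.prod.instIsAddHaarMeasure (volume : Measure (Fin N → ℝ)) (volume : Measure (Fin N → ℝ))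
  obtain ⟨G₀, U₀, η, t₀, δ, hG₀, h0, hU₀, hU₀ne, hη, hδ, hδt, hmin⟩ :=
    D.exists_localSmall_window hY hx₀ hv₁ hv₂ hKal (volume : Measure (PhaseSpace N))
  exact ⟨G₀, U₀, η, t₀, δ, hG₀, h0, hU₀, hU₀ne, hη, hδ, hδt, hmin⟩

/-- **At most one invariant probability measure for the Langevin kernels of a cell chain**
(`ω₂, γ > 0`, `lam, β ≥ 0`, `N ≥ 1`, `T_L > 0`, any `T_R`): local small set + LaSalle irreducibility
(`V_i'` injective, `Φ` with the origin as only critical point) + small-set cover.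
[cite: CuneoEckmannHairerReyBellet2018, Prop 3.6 and Prop 3.8] -/
theorem cellChain_invariant_unique_U3 {ω₂ lam β γ : ℝ} (hω : 0 < ω₂) (hl : 0 ≤ lam) (hβ : 0 ≤ β)
    (hγ : 0 < γ) (c : ℕ → Bool) (hN : 0 < N) {T_L : ℝ} (hTL : 0 < T_L) (T_R : ℝ)
    {μ ν : Measure (PhaseSpace N)} [IsProbabilityMeasure μ] [IsProbabilityMeasure ν]
    (hμ : ∀ t : ℝ≥0, Kernel.Invariant ((cellChain ω₂ lam β γ c).langevinKernel N T_L T_R t) μ)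
    (hν : ∀ t : ℝ≥0, Kernel.Invariant ((cellChain ω₂ lam β γ c).langevinKernel N T_L T_R t) ν) :
    μ = ν := by
  obtain ⟨G₀, U₀, η, t₀, δ, hG₀, h0, hU₀, ⟨y₀, hy₀⟩, hη, hδ, hδt, hmin⟩ :=
    cellChain_localSmall_U3 hω hl hβ hγ c hN hTL T_R
  have hPc : (cellChain ω₂ lam β γ c).UniformlyConfining := cellChain_uniformlyConfining hω hl hβ hγ.le c
  have hVinj : ∀ i, Function.Injective (deriv ((cellChain ω₂ lam β γ c).V i)) :=
    fun i => cellChain_deriv_V_injective_U3 ω₂ lam hβ γ c i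
  have hcrit : ∀ q : Fin N → ℝ, (∀ i, (cellChain ω₂ lam β γ c).dPotential N i q = 0) → q = 0 :=
    fun q hq => cellChain_eq_zero_of_dPotential_eq_zero_U3 hω hl hβ γ c N q hq
  refine hPc.invariant_unique_of_localSmall N (by exact hγ) hN hVinj hcrit T_L T_R hG₀ h0
    (ν₀ := η • (volume : Measure (PhaseSpace N)).restrict U₀) (y₀ := y₀)
    (fun V hV hyV => ?_) hδ hδt hmin hμ hν
  rw [Measure.smul_apply, Measure.restrict_apply hV.measurableSet, smul_eq_mul]
  exact ENNReal.mul_pos hη.ne' ((hV.inter hU₀).measure_pos volume ⟨y₀, hyV, hy₀⟩).ne'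

/-- **Registered stub `stub_cellChainInvariantUnique` of crux `PrefixSteadyStates` (line
`registered`): at most one invariant probability measure of the Langevin kernels of any cell chain**,
by `cellChain_invariant_unique_U3`. [cite: CuneoEckmannHairerReyBellet2018, Prop 3.6 and Prop 3.8] -/
theorem stub_cellChainInvariantUnique :
    ∀ ω₂ lam β γ : ℝ, 0 < ω₂ → 0 ≤ lam → 0 ≤ β → 0 < γ → ∀ (c : ℕ → Bool) (N : ℕ), 0 < N →
      ∀ T_L T_R : ℝ, 0 < T_L → 0 ≤ T_R →
        ∀ μ ν : Measure (PhaseSpace N), IsProbabilityMeasure μ → IsProbabilityMeasure ν →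
          (∀ t : ℝ≥0, ProbabilityTheory.Kernel.Invariant
              ((cellChain ω₂ lam β γ c).langevinKernel N T_L T_R t) μ) →
          (∀ t : ℝ≥0, ProbabilityTheory.Kernel.Invariant
              ((cellChain ω₂ lam β γ c).langevinKernel N T_L T_R t) ν) → μ = ν :=
  fun _ _ _ _ hω hl hβ hγ c _ hN _ T_R hTL _ _ _ hμP hνP hμ hν =>
    haveI := hμP
    haveI := hνP
    cellChain_invariant_unique_U3 hω hl hβ hγ c hN hTL T_R hμ hν

end Summit.AtomisticToContinuum.FouriersLaw.Theorems.PrefixSteadyStates.LineRegistered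

end
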